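import Summits.BirchSwinnertonDyer.BirchSwinnertonDyer.Theorems.ResidualThetaTransportAtTwoResidualSignedLambdaLowerCMAtTwoLocalBlockCountCofree
import Summits.BirchSwinnertonDyer.BirchSwinnertonDyer.Theorems.UniversalToricDescentLocalH1Transfer
import Literature.NumberTheory.EllipticCurves.GreenbergVatsal2000.GreenbergSelmerGroups
import Literature.NumberTheory.EllipticCurves.SubgroupSelmerCocycleCriteriaProofs
import Literature.NumberTheory.EllipticCurves.PeriodIndexCorestrictionLocal
import HarnessLib

/-!
# The GOOD-PLACE LOCAL BLOCK of RSL_g's one-pair count — the «`Prim = ⋂ ker locAway`» kernel: at a place `w ∤ 2` of the cyclotomic tower a class of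
# `H¹(ℚ_∞, A_ρ)` UNRAMIFIED at `w` is LOCALLY TRIVIAL at `w` (`loc_w s = 0` in `Dloc S κ ρ w`), Greenberg–Vatsal p. 17

Route `ResidualThetaTransportAtTwo` (RTT), crux RSL_g `ResidualSignedLambdaLowerCMAtTwo` (stmt-BirchSwinnertonDyer-22608); width seat
`prover-bsd-wall-tp2-p2x-w3` g16 (`--supports 22608 --as helper`, closes nothing). THEOREMS ONLY (no definition, no named fact, no instance, no notation,
no `sorry`). Sixth file of the local-block chain. The AwayTwo frame (`Cruxes/ResidualSignedLambdaLowerCMAtTwo/AWAYTWO-FRAME-g18.md` §1–§3; carrier of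
record `Dloc S κ ρ w ≡ subgroupH1 (localSubgroup κ.kerSubgroup ℚ_w) (Cofree (ρ.toLocal w) F)`, bus 2026-08-29T04:56:41Z) localises a class `s` of
`subgroupH1 κ.kerSubgroup (Cofree ρ F)` by `locAway s w c := loc_w (conjH1 (rep c) s)`, `loc_w` = pull-back along `resGalSubgroup κ.kerSubgroup ℚ_w :
localSubgroup κ.kerSubgroup ℚ_w →ₜ* κ.kerSubgroup`, and the S1⊕ text carries the reading «`Prim = ⋂ ker locAway`» of the pin `π.hSel₀`, whose `S₀`-clause is
`∀ w ∈ S₀, ∀ σ, conjH1 σ s ∈ GreenbergVatsal2000.unramifiedKer κ.kerSubgroup (Cofree ρ F) w` (UNRAMIFIED at the chosen place above `w`). This file proves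
the implication that reading needs, for every place `w ∤ 2` not split completely in `κ` (free for the cyclotomic `κ`):

* **`loc_eq_zero_of_mem_unramifiedKer`** — `s ∈ unramifiedKer κ.kerSubgroup (Cofree ρ F) w ⟹ loc_w s = 0` in `Dloc S κ ρ w`, with
  `loc_w := resH1Hom (resGalSubgroup κ.kerSubgroup ℚ_w) (id : Cofree ρ F →+ Cofree (ρ.toLocal w) F) _` (the subgroup-`H¹` spelling of the frame's `kerLocOf`);
  **`loc_conjH1_eq_zero_of_mem_unramifiedKer`** — the same for `conjH1 σ s` (all cosets `c`, `σ = rep c`).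
  Proof: on cocycles, the pull-back of `s` to `I_{ℚ_w} ∩ U∞` factors through `inertiaIn κ.kerSubgroup w` (`GreenbergSelmer.inertia w = res(I_{ℚ_w})`,
  `decomp w = range res`), where `s` is a coboundary by hypothesis; and `H¹(U∞, A_ρ) → H¹(I_{ℚ_w} ∩ U∞, A_ρ)` is INJECTIVE because `U∞/(I ∩ U∞)` is pro-prime-to-`2`
  (route UTD's `resSubgroup_localSubgroup_bijective`, the bijection `res : H¹(Hi, A) ⥲ H¹(I ∩ Hi, A)^{Hi}` of Greenberg–Vatsal's proof of Prop. 2.4).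
* `mem_unramifiedKer_of_loc_eq_zero` — the (trivial) converse: locally trivial ⟹ unramified.

So on `Sel₀ ⊆ Prim` every `locAway` component vanishes — the (ORTH)/membership side of the one-pair count at the good places. BSD is not proved by any of this;
RSL_g (22608) is not proved here.

References: [GreenbergVatsal2000] §2 p. 17 («`G_η/I_η` has profinite order prime to `p`, so `[σ|_{G_η}] = 0 ⟺ [σ|_{I_η}] = 0`») and Prop. (2.4) (proof, arXiv
p. 22); [GreenbergLNM1716] §3 Lemma 3.3; [SerreGaloisCohomology1997] I §2.4, I §2.6 (b), I §5.1; [NeukirchANT1999] Ch. II §9 Prop. (9.6).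
-/

set_option autoImplicit false
-- the Theorems namespace of this sub repeats the summit name by design (D-0017 nested layout)
set_option linter.dupNamespace false

noncomputable section

open scoped Classical

namespace Summit.BirchSwinnertonDyer.BirchSwinnertonDyer.Theorems.ThetaTransport.LocalBlockCount

open NumberField IsDedekindDomain Field
open Literature.NumberTheory.EllipticCurves Literature.NumberTheory.GaloisRepresentations
  Literature.NumberTheory.GaloisRepresentations.IsNonarchimedeanLocalField
  Literature.NumberTheory.EllipticCurves.GreenbergSelmer IsDedekindDomain.HeightOneSpectrum
  Summit.BirchSwinnertonDyer.BirchSwinnertonDyer.Theorems.UniversalToricDescentLocalH1Transfer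

section Unramified

variable (S : Set (PadicAlgCl 2)) (ρ : FramedGaloisRep ℚ (padicCoeffIntegers S) 2) (κ : ZpExtension ℚ 2) {w : HeightOneSpectrum (𝓞 ℚ)}

/-- **Unramified at `w` ⟹ locally trivial at `w` (`w ∤ 2` not split completely in `κ`)**: for a class `s ∈ H¹(Gal(ℚ̄/ℚ_∞), A_ρ)` in
`GreenbergVatsal2000.unramifiedKer κ.kerSubgroup (Cofree ρ F) w` (restriction to the inertia group `inertiaIn κ.kerSubgroup w` of the chosen place above `w`
vanishes), its localisation `loc_w s ∈ Dloc S κ ρ w = H¹(U∞ w, A_ρ|)` along `resGalSubgroup κ.kerSubgroup ℚ_w` vanishes. Greenberg–Vatsal: «`G_η/I_η` has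
profinite degree prime to `p`, so `[σ|_{G_η}] = 0` is equivalent to `[σ|_{I_η}] = 0`». [cite: GreenbergVatsal2000, §2 p. 17 and Prop. (2.4) (proof, arXiv p. 22)]
[cite: SerreGaloisCohomology1997, I §2.6 (b)] -/
theorem loc_eq_zero_of_mem_unramifiedKer (h2w : ((2 : ℕ) : 𝓞 ℚ) ∉ w.asIdeal)
    (hns : ∃ σ : absoluteGaloisGroup (w.adicCompletion ℚ), σ ∉ localSubgroup κ.kerSubgroup (w.adicCompletion ℚ))
    (s : subgroupH1 κ.kerSubgroup (Cofree ρ (padicCoeffField S)))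
    (hs : s ∈ GreenbergVatsal2000.unramifiedKer κ.kerSubgroup (Cofree ρ (padicCoeffField S)) w) :
    resH1Hom (resGalSubgroup κ.kerSubgroup (w.adicCompletion ℚ))
      (AddMonoidHom.mk' (fun a ↦ (a : Cofree (ρ.toLocal w) (padicCoeffField S))) (fun _ _ ↦ rfl) :
        Cofree ρ (padicCoeffField S) →+ Cofree (ρ.toLocal w) (padicCoeffField S))
      (fun _ _ ↦ rfl) s = 0 := by
  have hIn : (absInertia (w.adicCompletion ℚ)).Normal := absInertia_normal_holds (w.adicCompletion ℚ)
  -- the compatible pair (written out; no local abbreviations)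
  have hψ : ∀ (x : localSubgroup κ.kerSubgroup (w.adicCompletion ℚ)) (m : Cofree ρ (padicCoeffField S)),
      (AddMonoidHom.mk' (fun a ↦ (a : Cofree (ρ.toLocal w) (padicCoeffField S))) (fun _ _ ↦ rfl) :
        Cofree ρ (padicCoeffField S) →+ Cofree (ρ.toLocal w) (padicCoeffField S)) (resGalSubgroup κ.kerSubgroup (w.adicCompletion ℚ) x • m) =
      x • (AddMonoidHom.mk' (fun a ↦ (a : Cofree (ρ.toLocal w) (padicCoeffField S))) (fun _ _ ↦ rfl) :
        Cofree ρ (padicCoeffField S) →+ Cofree (ρ.toLocal w) (padicCoeffField S)) m := by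
    intro x m
    obtain ⟨u, rfl⟩ := cofreeMk_surjective (padicCoeffField S) ρ m
    show cofreeMk (padicCoeffField S) ρ (fracRepresentation (padicCoeffField S) ρ
        ((resGalSubgroup κ.kerSubgroup (w.adicCompletion ℚ) x : κ.kerSubgroup) : absoluteGaloisGroup ℚ) u) =
      cofreeMk (padicCoeffField S) (ρ.toLocal w) (fracRepresentation (padicCoeffField S) (ρ.toLocal w)
        ((x : localSubgroup κ.kerSubgroup (w.adicCompletion ℚ)) : absoluteGaloisGroup (w.adicCompletion ℚ)) u)
    simp only [fracRepresentation_apply_apply, FramedGaloisRep.toLocal_apply]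
    rfl
  -- a cocycle of `s` and the coboundary datum on the inertia group of the chosen place above `w`
  obtain ⟨z, rfl⟩ := oneCocycleClass_surjective _ s
  obtain ⟨m, hm⟩ := (CocycleCriteria.resH1Hom_oneCocycleClass_eq_zero_iff (inertiaInToH κ.kerSubgroup w)
    (AddMonoidHom.id (Cofree ρ (padicCoeffField S))) (fun _ _ ↦ rfl) z).mp hs
  -- the localised class is the class of the pulled-back cocycle
  have hy := resH1Hom_oneCocycleClass (resGalSubgroup κ.kerSubgroup (w.adicCompletion ℚ))
    (AddMonoidHom.mk' (fun a ↦ (a : Cofree (ρ.toLocal w) (padicCoeffField S))) (fun _ _ ↦ rfl) :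
      Cofree ρ (padicCoeffField S) →+ Cofree (ρ.toLocal w) (padicCoeffField S)) hψ z
  -- injectivity of `res : H¹(U∞, A_ρ) → H¹(I_{ℚ_w} ∩ U∞, A_ρ)` (the quotient is pro-prime-to-`2`): it suffices that the restriction vanishes
  refine (resSubgroup_localSubgroup_bijective κ h2w hns (exists_pow_smul_cofree_eq_zero S (ρ.toLocal w)) (continuous_smul_cofree S ρ)
    (hIn := hIn)).1 (Subtype.ext ?_)
  show resSubgroup _ _ 1 _ = resSubgroup _ _ 1 0
  rw [map_zero, hy, resSubgroup_oneCocycleClass, oneCocycleClass_eq_zero_iff]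
  let m' : Cofree (ρ.toLocal w) (padicCoeffField S) := m
  refine ⟨m', fun g ↦ ?_⟩
  -- `g ∈ I_{ℚ_w} ∩ U∞` restricts into `inertiaIn κ.kerSubgroup w`
  have hgI : ((g : localSubgroup κ.kerSubgroup (w.adicCompletion ℚ)) : absoluteGaloisGroup (w.adicCompletion ℚ)) ∈ absInertia (w.adicCompletion ℚ) :=
    Subgroup.mem_subgroupOf.mp g.2
  have hgD : absGaloisRestrict ℚ (w.adicCompletion ℚ) ((g : localSubgroup κ.kerSubgroup (w.adicCompletion ℚ)) : absoluteGaloisGroup (w.adicCompletion ℚ)) ∈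
      decomp (K := ℚ) w := (mem_decomp_iff w _).mpr ⟨_, rfl⟩
  have hgH : absGaloisRestrict ℚ (w.adicCompletion ℚ) ((g : localSubgroup κ.kerSubgroup (w.adicCompletion ℚ)) : absoluteGaloisGroup (w.adicCompletion ℚ)) ∈
      κ.kerSubgroup := (mem_localSubgroup_iff κ.kerSubgroup (w.adicCompletion ℚ) _).mp (g : localSubgroup κ.kerSubgroup (w.adicCompletion ℚ)).2
  have hgIn : absGaloisRestrict ℚ (w.adicCompletion ℚ) ((g : localSubgroup κ.kerSubgroup (w.adicCompletion ℚ)) : absoluteGaloisGroup (w.adicCompletion ℚ)) ∈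
      inertia (K := ℚ) w := Subgroup.mem_map_of_mem _ hgI
  let yg : inertiaIn κ.kerSubgroup w := ⟨⟨_, hgD⟩, (mem_inertiaIn_iff κ.kerSubgroup w _).mpr ⟨hgH, hgIn⟩⟩
  have hθg : resGalSubgroup κ.kerSubgroup (w.adicCompletion ℚ) (g : localSubgroup κ.kerSubgroup (w.adicCompletion ℚ)) = inertiaInToH κ.kerSubgroup w yg :=
    Subtype.ext rfl
  have hmg : z.1 (inertiaInToH κ.kerSubgroup w yg) = yg • m - m := hm yg
  show (AddMonoidHom.mk' (fun a ↦ (a : Cofree (ρ.toLocal w) (padicCoeffField S))) (fun _ _ ↦ rfl) :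
      Cofree ρ (padicCoeffField S) →+ Cofree (ρ.toLocal w) (padicCoeffField S))
      (z.1 (resGalSubgroup κ.kerSubgroup (w.adicCompletion ℚ) (g : localSubgroup κ.kerSubgroup (w.adicCompletion ℚ)))) =
    ((g : localSubgroup κ.kerSubgroup (w.adicCompletion ℚ)) : absoluteGaloisGroup (w.adicCompletion ℚ)) • m' - m'
  rw [hθg, hmg, map_sub]
  rfl

/-- **The same for every conjugate** `conjH1 σ s` (all cosets `c : C w`, `σ = rep c`): the `S₀`-clause of `π.hSel₀` kills every `locAway s w c`.
[cite: GreenbergVatsal2000, §2 p. 17] -/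
theorem loc_conjH1_eq_zero_of_mem_unramifiedKer (h2w : ((2 : ℕ) : 𝓞 ℚ) ∉ w.asIdeal)
    (hns : ∃ σ : absoluteGaloisGroup (w.adicCompletion ℚ), σ ∉ localSubgroup κ.kerSubgroup (w.adicCompletion ℚ))
    (s : subgroupH1 κ.kerSubgroup (Cofree ρ (padicCoeffField S))) (σ : absoluteGaloisGroup ℚ)
    (hs : conjH1 κ.kerSubgroup (Cofree ρ (padicCoeffField S)) σ s ∈ GreenbergVatsal2000.unramifiedKer κ.kerSubgroup (Cofree ρ (padicCoeffField S)) w) :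
    resH1Hom (resGalSubgroup κ.kerSubgroup (w.adicCompletion ℚ))
      (AddMonoidHom.mk' (fun a ↦ (a : Cofree (ρ.toLocal w) (padicCoeffField S))) (fun _ _ ↦ rfl) :
        Cofree ρ (padicCoeffField S) →+ Cofree (ρ.toLocal w) (padicCoeffField S))
      (fun _ _ ↦ rfl) (conjH1 κ.kerSubgroup (Cofree ρ (padicCoeffField S)) σ s) = 0 :=
  loc_eq_zero_of_mem_unramifiedKer S ρ κ h2w hns _ hs

/-- **Converse (trivial): locally trivial at `w` ⟹ unramified at `w`** (restriction to `inertiaIn κ.kerSubgroup w` factors through `loc_w`: an element of the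
inertia group of the chosen place is `res_w` of a local inertia element). [cite: GreenbergVatsal2000, §2 p. 17] [cite: NeukirchANT1999, Ch. II §9 Prop. (9.6)] -/
theorem mem_unramifiedKer_of_loc_eq_zero (s : subgroupH1 κ.kerSubgroup (Cofree ρ (padicCoeffField S)))
    (hs : resH1Hom (resGalSubgroup κ.kerSubgroup (w.adicCompletion ℚ))
      (AddMonoidHom.mk' (fun a ↦ (a : Cofree (ρ.toLocal w) (padicCoeffField S))) (fun _ _ ↦ rfl) :
        Cofree ρ (padicCoeffField S) →+ Cofree (ρ.toLocal w) (padicCoeffField S))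
      (fun _ _ ↦ rfl) s = 0) :
    s ∈ GreenbergVatsal2000.unramifiedKer κ.kerSubgroup (Cofree ρ (padicCoeffField S)) w := by
  let F := padicCoeffField S
  let Hi : Subgroup (absoluteGaloisGroup (w.adicCompletion ℚ)) := localSubgroup κ.kerSubgroup (w.adicCompletion ℚ)
  let θ : Hi →ₜ* κ.kerSubgroup := resGalSubgroup κ.kerSubgroup (w.adicCompletion ℚ)
  let ψ : Cofree ρ F →+ Cofree (ρ.toLocal w) F := AddMonoidHom.mk' (fun a ↦ (a : Cofree (ρ.toLocal w) F)) (fun _ _ ↦ rfl)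
  have hψ : ∀ (x : Hi) (m : Cofree ρ F), ψ (θ x • m) = x • ψ m := by
    intro x m
    obtain ⟨u, rfl⟩ := cofreeMk_surjective F ρ m
    show cofreeMk F ρ (fracRepresentation F ρ (θ x : absoluteGaloisGroup ℚ) u) =
      cofreeMk F (ρ.toLocal w) (fracRepresentation F (ρ.toLocal w) ((x : Hi) : absoluteGaloisGroup (w.adicCompletion ℚ)) u)
    simp only [fracRepresentation_apply_apply, FramedGaloisRep.toLocal_apply]
    rfl
  obtain ⟨z, rfl⟩ := oneCocycleClass_surjective _ s
  obtain ⟨n, hn⟩ := (CocycleCriteria.resH1Hom_oneCocycleClass_eq_zero_iff θ ψ hψ z).mp hs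
  -- the same element of the common carrier `F²/𝒪²`, viewed in `Cofree ρ F`
  let n' : Cofree ρ F := n
  refine (CocycleCriteria.resH1Hom_oneCocycleClass_eq_zero_iff (inertiaInToH κ.kerSubgroup w) (AddMonoidHom.id (Cofree ρ F))
    (fun _ _ ↦ rfl) z).mpr ⟨n', fun y ↦ ?_⟩
  -- `y ∈ inertiaIn κ.kerSubgroup w`: `(y : Γ_ℚ) = res_w τ` with `τ ∈ I_{ℚ_w}`, and `τ ∈ U∞` because `res_w τ ∈ κ.kerSubgroup`
  obtain ⟨hyH, hyI⟩ := (mem_inertiaIn_iff κ.kerSubgroup w (y : decomp (K := ℚ) w)).mp y.2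
  obtain ⟨τ, hτI, hτ⟩ := Subgroup.mem_map.mp hyI
  have hτ' : absGaloisRestrict ℚ (w.adicCompletion ℚ) τ = ((y : decomp (K := ℚ) w) : absoluteGaloisGroup ℚ) := hτ
  have hτU : τ ∈ Hi := (mem_localSubgroup_iff κ.kerSubgroup (w.adicCompletion ℚ) τ).mpr (by
    show absGaloisRestrict ℚ (w.adicCompletion ℚ) τ ∈ κ.kerSubgroup
    rw [hτ']; exact hyH)
  have hθ : θ ⟨τ, hτU⟩ = inertiaInToH κ.kerSubgroup w y := Subtype.ext hτ'
  have key := hn ⟨τ, hτU⟩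
  rw [hθ] at key
  -- `key : ψ (z (inertiaInToH y)) = ⟨τ, _⟩ • n - n` in `Cofree (ρ.toLocal w) F`; the two actions are `ρ(res_w τ) = ρ(y)` on the same carrier
  have key2 : (z.1 (inertiaInToH κ.kerSubgroup w y) : Cofree ρ F) = absGaloisRestrict ℚ (w.adicCompletion ℚ) τ • n' - n' := by
    obtain ⟨u, hu⟩ := cofreeMk_surjective F ρ n'
    have hu' : cofreeMk F (ρ.toLocal w) u = n := hu
    have h1 : ((⟨τ, hτU⟩ : Hi) • n - n : Cofree (ρ.toLocal w) F) =
        (absGaloisRestrict ℚ (w.adicCompletion ℚ) τ • n' - n' : Cofree ρ F) := by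
      rw [← hu', ← hu]
      show ((⟨τ, hτU⟩ : Hi) : absoluteGaloisGroup (w.adicCompletion ℚ)) • cofreeMk F (ρ.toLocal w) u - cofreeMk F (ρ.toLocal w) u =
        absGaloisRestrict ℚ (w.adicCompletion ℚ) τ • cofreeMk F ρ u - cofreeMk F ρ u
      rw [smul_cofreeMk, smul_cofreeMk]
      simp only [fracRepresentation_apply_apply, FramedGaloisRep.toLocal_apply]
      rfl
    exact key.trans h1
  show (z.1 (inertiaInToH κ.kerSubgroup w y) : Cofree ρ F) = ((y : decomp (K := ℚ) w) : absoluteGaloisGroup ℚ) • n' - n'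
  rw [key2, hτ']

end Unramified

end Summit.BirchSwinnertonDyer.BirchSwinnertonDyer.Theorems.ThetaTransport.LocalBlockCount

end
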